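import Summits.KontsevichZagierPeriods.KontsevichZagierPeriods.Theorems.FermatIsogenyDeepWordSectorP01

/-! # `FermatIsogenyDeepWordSectorP02` — part 2/9 of the mechanical ≤400-line split of `DeepWordSector.lean` (sha256 5e8cd5c1c920648a…)
Source: decomp-kz lens-5 g22 DeepWordSector.lean v10 @5e8cd5c1 (the deep Beta-word sector node: bridge S ⟺ BetaWordTower ∧ WordSectorComplete, finite boxes, box ladder, shadow arithmetic, Chudnovsky levels; critic CLEARED g6-2/3/4/11/13/16/19); --supports stmt-KontsevichZagierPeriods-3898.
Split by census-1 g10 `gen/splitlean.py`: scopes re-opened with their `open`/`variable`/`set_option` context; mathematics and declaration order unchanged. -/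

namespace Summit.KontsevichZagierPeriods.FermatIsogeny.DeepTargets
open Literature.NumberTheory.Transcendental MeasureTheory
open Summit.KontsevichZagierPeriods.KontsevichZagierPeriods.Theses.FermatIsogeny (BetaLinearSector BetaProductSector FermatSectorComplete)

/-- **The word pairs** `S_word`: the formal differences `[ρ] − [ρ']` of the hypothesis pairs of ALL the sectors
`BetaWordSector k`, `k ∈ ℕ` (pinned `k`-dimensional Beta-word representations on `(0,1)^k`, the second scaled by a real
algebraic `q`, of equal value). `S_lin ∪ S_prod` of crux 14252 is the part `k ≤ 2` (`linProdPairs_subset_wordPairs`).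
[this node] -/
def wordPairs : Set KZ.FormalRep :=
  {z | ∃ (k : ℕ) (a b a' b' : Fin k → ℚ) (q : ℝ) (ρ ρ' : KZ.IntegralRep k),
    (∀ i, 0 < a i) ∧ (∀ i, 0 < b i) ∧ (∀ i, 0 < a' i) ∧ (∀ i, 0 < b' i) ∧ IsAlgebraic ℚ q ∧
    ρ.domain = {x | ∀ i, x i ∈ Set.Ioo (0:ℝ) 1} ∧
    Set.EqOn ρ.integrand (fun x => ∏ i, (x i) ^ ((a i : ℝ) - 1) * (1 - x i) ^ ((b i : ℝ) - 1)) ρ.domain ∧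
    ρ'.domain = {x | ∀ i, x i ∈ Set.Ioo (0:ℝ) 1} ∧
    Set.EqOn ρ'.integrand (fun x => q * ∏ i, (x i) ^ ((a' i : ℝ) - 1) * (1 - x i) ^ ((b' i : ℝ) - 1)) ρ'.domain ∧
    ρ.value = ρ'.value ∧ z = KZ.of ρ - KZ.of ρ'}

/-- **Relative completeness of the KZ calculus modulo the word pairs** (`S_word` granted as extra axioms): any two
representations of KZ's literal shape with equal value are connected in `relations ⊔ closure S_word`. WEAKER than crux
14252 `FermatSectorComplete` (which grants only `S_lin ∪ S_prod ⊆ S_word`): `wordSectorComplete_of_fermatSectorComplete`.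
[this node] -/
def WordSectorComplete : Prop :=
  ∀ ⦃n m : ℕ⦄ (r : KZ.IntegralRep n) (r' : KZ.IntegralRep m), r.IsRational → r'.IsRational → r.value = r'.value →
    KZ.of r - KZ.of r' ∈ KZ.relations ⊔ AddSubgroup.closure wordPairs

/-- **The tower says exactly: every word pair is a relation.** [this node] -/
theorem betaWordTower_iff_wordPairs_subset : BetaWordTower ↔ wordPairs ⊆ (KZ.relations : Set KZ.FormalRep) := by
  constructor
  · rintro h z ⟨k, a, b, a', b', q, ρ, ρ', ha, hb, ha', hb', hq, hd, hi, hd', hi', hv, rfl⟩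
    exact h k a b a' b' q ha hb ha' hb' hq ρ ρ' hd hi hd' hi' hv
  · intro h k a b a' b' q ha hb ha' hb' hq ρ ρ' hd hi hd' hi' hv
    exact h ⟨k, a, b, a', b', q, ρ, ρ', ha, hb, ha', hb', hq, hd, hi, hd', hi', hv, rfl⟩

/-- Under the tower the enlarged relation group collapses: `relations ⊔ closure S_word = relations`. [this node] -/
theorem sup_closure_wordPairs_eq (h : BetaWordTower) :
    KZ.relations ⊔ AddSubgroup.closure wordPairs = KZ.relations :=
  sup_eq_left.mpr ((AddSubgroup.closure_le _).mpr (betaWordTower_iff_wordPairs_subset.mp h))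

/-- **`S_lin ∪ S_prod ⊆ S_word`**: the generators granted by crux 14252 are the word pairs of length `1` and `2` (the
reindexing of `betaWordSector_one_iff` / `betaWordSector_two_iff`). [this node] -/
theorem linProdPairs_subset_wordPairs :
    ({z : KZ.FormalRep | ∃ (a b a' b' : ℚ) (c : ℝ) (ρ ρ' : KZ.IntegralRep 1), 0 < a ∧ 0 < b ∧ 0 < a' ∧ 0 < b' ∧
        IsAlgebraic ℚ c ∧ ρ.domain = {x | x 0 ∈ Set.Ioo (0:ℝ) 1} ∧
        Set.EqOn ρ.integrand (fun x => (x 0) ^ ((a:ℝ) - 1) * (1 - x 0) ^ ((b:ℝ) - 1)) ρ.domain ∧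
        ρ'.domain = {x | x 0 ∈ Set.Ioo (0:ℝ) 1} ∧
        Set.EqOn ρ'.integrand (fun x => c * (x 0) ^ ((a':ℝ) - 1) * (1 - x 0) ^ ((b':ℝ) - 1)) ρ'.domain ∧
        ρ.value = ρ'.value ∧ z = KZ.of ρ - KZ.of ρ'} ∪
      {z : KZ.FormalRep | ∃ (a b e d a' b' e' d' : ℚ) (q : ℝ) (ρ ρ' : KZ.IntegralRep 2), 0 < a ∧ 0 < b ∧ 0 < e ∧
        0 < d ∧ 0 < a' ∧ 0 < b' ∧ 0 < e' ∧ 0 < d' ∧ IsAlgebraic ℚ q ∧ ρ.domain = {x | ∀ i, x i ∈ Set.Ioo (0:ℝ) 1} ∧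
        Set.EqOn ρ.integrand (fun x => (x 0) ^ ((a:ℝ) - 1) * (1 - x 0) ^ ((b:ℝ) - 1) * (x 1) ^ ((e:ℝ) - 1) *
          (1 - x 1) ^ ((d:ℝ) - 1)) ρ.domain ∧
        ρ'.domain = {x | ∀ i, x i ∈ Set.Ioo (0:ℝ) 1} ∧
        Set.EqOn ρ'.integrand (fun x => q * (x 0) ^ ((a':ℝ) - 1) * (1 - x 0) ^ ((b':ℝ) - 1) * (x 1) ^ ((e':ℝ) - 1) *
          (1 - x 1) ^ ((d':ℝ) - 1)) ρ'.domain ∧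
        ρ.value = ρ'.value ∧ z = KZ.of ρ - KZ.of ρ'}) ⊆ wordPairs := by
  rintro z (⟨a, b, a', b', c, ρ, ρ', ha, hb, ha', hb', hc, hd, hi, hd', hi', hv, rfl⟩ |
    ⟨a, b, e, d, a', b', e', d', q, ρ, ρ', ha, hb, he, hd0, ha', hb', he', hd0', hq, hd, hi, hd', hi', hv, rfl⟩)
  · refine ⟨1, ![a], ![b], ![a'], ![b'], c, ρ, ρ', ?_, ?_, ?_, ?_, hc, hd.trans cube_one_eq, ?_,
      hd'.trans cube_one_eq, ?_, hv, rfl⟩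
    · intro i; fin_cases i; simpa using ha
    · intro i; fin_cases i; simpa using hb
    · intro i; fin_cases i; simpa using ha'
    · intro i; fin_cases i; simpa using hb'
    · intro x hx
      rw [hi hx]
      simp only [Fin.prod_univ_one, Fin.isValue, Matrix.cons_val_fin_one]
    · intro x hx
      rw [hi' hx]
      simp only [Fin.prod_univ_one, Fin.isValue, Matrix.cons_val_fin_one]
      ring
  · refine ⟨2, ![a, e], ![b, d], ![a', e'], ![b', d'], q, ρ, ρ', ?_, ?_, ?_, ?_, hq, hd, ?_, hd', ?_, hv, rfl⟩
    · intro i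
      fin_cases i
      · simpa using ha
      · simpa using he
    · intro i
      fin_cases i
      · simpa using hb
      · simpa using hd0
    · intro i
      fin_cases i
      · simpa using ha'
      · simpa using he'
    · intro i
      fin_cases i
      · simpa using hb'
      · simpa using hd0'
    · intro x hx
      rw [hi hx]
      simp only [Fin.prod_univ_two, Fin.isValue, Matrix.cons_val_zero, Matrix.cons_val_one]
      ring
    · intro x hx
      rw [hi' hx]
      simp only [Fin.prod_univ_two, Fin.isValue, Matrix.cons_val_zero, Matrix.cons_val_one]
      ring

/-- **Crux 14252 implies completeness modulo the word pairs** (more axioms granted, completeness only easier).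
[this node] -/
theorem wordSectorComplete_of_fermatSectorComplete (h : FermatSectorComplete) : WordSectorComplete := by
  intro n m r r' hr hr' hv
  exact sup_le_sup_left (AddSubgroup.closure_mono linProdPairs_subset_wordPairs) KZ.relations (h r r' hr hr' hv)

/-- **The summit implies the tower** (each `BetaWordSector k` is an instance of Conjecture 1 for `ℚ`-semialgebraic
representations, `kzPeriodConjecture'_iff_isRational`). [this node] -/
theorem betaWordTower_of_summit (h : _root_.KontsevichZagierPeriods) : BetaWordTower := by
  have h' : KZPeriodConjecture' := kzPeriodConjecture'_iff_isRational.mpr (KontsevichZagierPeriods_iff.mp h)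
  intro k a b a' b' q _ _ _ _ _ ρ ρ' _ _ _ _ hv
  exact h' ρ ρ' hv

/-- **The summit implies completeness modulo the word pairs** (trivially: `relations ≤ relations ⊔ _`). [this node] -/
theorem wordSectorComplete_of_summit (h : _root_.KontsevichZagierPeriods) : WordSectorComplete := by
  intro n m r r' hr hr' hv
  exact (le_sup_left : KZ.relations ≤ KZ.relations ⊔ AddSubgroup.closure wordPairs)
    (KontsevichZagierPeriods_iff.mp h r r' hr hr' hv)

/-- **Closing from the new split**: the tower and completeness modulo the word pairs give the summit. [this node] -/
theorem summit_of_betaWordTower_of_wordSectorComplete (hT : BetaWordTower) (hC : WordSectorComplete) :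
    _root_.KontsevichZagierPeriods := by
  rw [KontsevichZagierPeriods_iff]
  intro n m r r' hr hr' hv
  have hmem := hC r r' hr hr' hv
  rw [sup_closure_wordPairs_eq hT] at hmem
  exact hmem

/-- **THE BRIDGE (certified conjunct split of the summit).** `KontsevichZagierPeriods ↔ BetaWordTower ∧ WordSectorComplete`:
ALL the Γ- and Beta-content of Conjecture 1 (every deep class `a_{p·q}` of census (α), at its own level, in its own word length)
sits in the tower, and the complement is completeness of the calculus modulo `S_word` — WEAKER than crux 14252
(`wordSectorComplete_of_fermatSectorComplete`), while the tower is STRONGER than cruxes 3898 ⟹ 3897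
(`sectors_of_betaWordSector_three`, `betaWordSector_of_le`). Compare the tree's `BetaLinearOfProduct.closes_without_betaLinear :
BetaProductSector → FermatSectorComplete → KontsevichZagierPeriods`: there the word pairs of length `≥ 3` (census (α): the
classes `a_{5·13}`, `a_{7·11}`, `a_{5·17}`, …) are hidden inside the completeness crux; here they are on the Beta side, typed.
[this node] -/
theorem summit_iff_betaWordTower_and_wordSectorComplete :
    _root_.KontsevichZagierPeriods ↔ BetaWordTower ∧ WordSectorComplete :=
  ⟨fun h => ⟨betaWordTower_of_summit h, wordSectorComplete_of_summit h⟩,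
    fun h => summit_of_betaWordTower_of_wordSectorComplete h.1 h.2⟩

/-- The route's own closing, recovered through the bridge: `BetaWordTower → FermatSectorComplete → KontsevichZagierPeriods`.
[this node; cf. tree `BetaLinearOfProduct.closes_without_betaLinear`] -/
theorem summit_of_betaWordTower_of_fermatSectorComplete (hT : BetaWordTower) (hF : FermatSectorComplete) :
    _root_.KontsevichZagierPeriods :=
  summit_of_betaWordTower_of_wordSectorComplete hT (wordSectorComplete_of_fermatSectorComplete hF)

/-! ### Level 65 — the Koblitz–Ogus certificate of `c_65` -/

/-- Multiplicity vector of the Γ-monomial `c_65` (numerators `/65`: `+` at [1, 3, 8, 11, 16, 20, 21, 26], `−` at [2, 4, 5, 12, 15, 17, 19, 32]). -/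
def mult65 : ℕ → ℤ := fun i =>
  if i = 1 then (1:ℤ) else if i = 3 then 1 else if i = 8 then 1 else if i = 11 then 1 else if i = 16 then 1 else
  if i = 20 then 1 else if i = 21 then 1 else if i = 26 then 1 else if i = 2 then -1 else if i = 4 then -1 else
  if i = 5 then -1 else if i = 12 then -1 else if i = 15 then -1 else if i = 17 then -1 else if i = 19 then -1 else
  if i = 32 then -1 else 0

/-- Expansion of a sum over `{1,…,64}` against `mult65`. [folklore] -/
theorem mult65_sum (F : ℕ → ℚ) :
    ∑ i ∈ Finset.Ico 1 65, ((mult65 i : ℤ) : ℚ) * F i =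
      F 1 + F 3 + F 8 + F 11 + F 16 + F 20 + F 21 + F 26 - F 2 - F 4 - F 5 - F 12 - F 15 - F 17 - F 19 - F 32 := by
  rw [Finset.sum_Ico_eq_sum_range]
  simp [Finset.sum_range_succ, mult65]
  ring

/-- Product form of `mult65_sum`. [folklore] -/
theorem mult65_prod (G : ℕ → ℂ) :
    ∏ i ∈ Finset.Ico 1 65, G i ^ (mult65 i) =
      G 1 * G 3 * G 8 * G 11 * G 16 * G 20 * G 21 * G 26 *
        (G 2)⁻¹ * (G 4)⁻¹ * (G 5)⁻¹ * (G 12)⁻¹ * (G 15)⁻¹ * (G 17)⁻¹ * (G 19)⁻¹ * (G 32)⁻¹ := by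
  rw [Finset.prod_Ico_eq_prod_range]
  simp only [mult65, Finset.prod_range_succ, Finset.prod_range_zero, Nat.reduceSub, Nat.reduceAdd,
    Nat.reduceEqDiff, ↓reduceIte, zpow_zero, zpow_one, zpow_neg, one_mul, mul_one]
  ring

/-- **KO certificate, level 65**: the Γ-monomial `mult65` has Hodge type with `c = 0` — a finite check on `u mod 65`
(`⟨1u⟩+⟨3u⟩+⟨8u⟩+⟨11u⟩+⟨16u⟩+⟨20u⟩+⟨21u⟩+⟨26u⟩ = ⟨2u⟩+⟨4u⟩+⟨5u⟩+⟨12u⟩+⟨15u⟩+⟨17u⟩+⟨19u⟩+⟨32u⟩` for the 48 units). [this node] -/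
theorem isHodgeType65 : IsHodgeTypeGammaMonomial 65 mult65 0 := by
  intro u hu
  rw [mult65_sum]
  have hf : ∀ i : ℕ, Int.fract ((u : ℚ) * (i : ℚ) / ((65 : ℕ) : ℚ)) =
      (((u * i) % 65 : ℕ) : ℚ) / ((65 : ℕ) : ℚ) := by
    intro i
    rw [show (u : ℚ) * (i : ℚ) / ((65 : ℕ) : ℚ) = ((u * i : ℕ) : ℚ) / ((65 : ℕ) : ℚ) by
      push_cast; ring]
    exact Int.fract_div_natCast_eq_div_natCast_mod
  rw [hf 1, hf 3, hf 8, hf 11, hf 16, hf 20, hf 21, hf 26, hf 2, hf 4, hf 5, hf 12, hf 15, hf 17, hf 19, hf 32]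
  have hr : u % 65 < 65 := Nat.mod_lt _ (by norm_num)
  have hg : Nat.gcd (u % 65) 65 = 1 := by
    rw [← Nat.gcd_rec]
    exact Nat.Coprime.gcd_eq_one hu.symm
  have key : ∀ r, r < 65 → Nat.gcd r 65 = 1 →
      (r * 1) % 65 + (r * 3) % 65 + (r * 8) % 65 + (r * 11) % 65 + (r * 16) % 65 + (r * 20) % 65 + (r * 21) % 65 + (r * 26) % 65 =
        (r * 2) % 65 + (r * 4) % 65 + (r * 5) % 65 + (r * 12) % 65 + (r * 15) % 65 + (r * 17) % 65 + (r * 19) % 65 + (r * 32) % 65 := by decide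
  have hN := key (u % 65) hr hg
  have e : ∀ i : ℕ, (u * i) % 65 = (u % 65 * i) % 65 := fun i =>
    ((Nat.mod_modEq u 65).mul_right i).symm
  rw [← e 1, ← e 3, ← e 8, ← e 11, ← e 16, ← e 20, ← e 21, ← e 26, ← e 2, ← e 4, ← e 5, ← e 12, ← e 15, ← e 17, ← e 19, ← e 32] at hN
  have hQ : ((u * 1 % 65 : ℕ) : ℚ) + ((u * 3 % 65 : ℕ) : ℚ) + ((u * 8 % 65 : ℕ) : ℚ) + ((u * 11 % 65 : ℕ) : ℚ) + ((u * 16 % 65 : ℕ) : ℚ) + ((u * 20 % 65 : ℕ) : ℚ) + ((u * 21 % 65 : ℕ) : ℚ) + ((u * 26 % 65 : ℕ) : ℚ) =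
      ((u * 2 % 65 : ℕ) : ℚ) + ((u * 4 % 65 : ℕ) : ℚ) + ((u * 5 % 65 : ℕ) : ℚ) + ((u * 12 % 65 : ℕ) : ℚ) +
        ((u * 15 % 65 : ℕ) : ℚ) + ((u * 17 % 65 : ℕ) : ℚ) + ((u * 19 % 65 : ℕ) : ℚ) + ((u * 32 % 65 : ℕ) : ℚ) := by
    exact_mod_cast hN
  push_cast
  linear_combination (1/65 : ℚ) * hQ

/-- **The constant `c_65` is real algebraic** (Deligne–Koblitz–Ogus via the tree's `deligne_gammaMonomial_algebraic_holds`,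
`d = 65`, `c = 0`; reduced arguments written in lowest terms). [this node] -/
theorem constant65_isAlgebraic :
    IsAlgebraic ℚ (Real.Gamma (1/65) * Real.Gamma (3/65) * Real.Gamma (8/65) * Real.Gamma (11/65) * Real.Gamma (16/65) * Real.Gamma (4/13) * Real.Gamma (21/65) * Real.Gamma (2/5) *
        (Real.Gamma (2/65))⁻¹ * (Real.Gamma (4/65))⁻¹ * (Real.Gamma (1/13))⁻¹ * (Real.Gamma (12/65))⁻¹ * (Real.Gamma (3/13))⁻¹ * (Real.Gamma (17/65))⁻¹ * (Real.Gamma (19/65))⁻¹ * (Real.Gamma (32/65))⁻¹) := by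
  have hKO := deligne_gammaMonomial_algebraic_holds 65 _ 0 (by norm_num) isHodgeType65
  unfold gammaTilde at hKO
  rw [mult65_prod, neg_zero, zpow_zero, one_mul] at hKO
  have hval : (Real.Gamma (((1 : ℕ) : ℝ) / (65 : ℕ)) : ℂ) *
      (Real.Gamma (((3 : ℕ) : ℝ) / (65 : ℕ)) : ℂ) *
      (Real.Gamma (((8 : ℕ) : ℝ) / (65 : ℕ)) : ℂ) *
      (Real.Gamma (((11 : ℕ) : ℝ) / (65 : ℕ)) : ℂ) *
      (Real.Gamma (((16 : ℕ) : ℝ) / (65 : ℕ)) : ℂ) *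
      (Real.Gamma (((20 : ℕ) : ℝ) / (65 : ℕ)) : ℂ) *
      (Real.Gamma (((21 : ℕ) : ℝ) / (65 : ℕ)) : ℂ) *
      (Real.Gamma (((26 : ℕ) : ℝ) / (65 : ℕ)) : ℂ) *
      ((Real.Gamma (((2 : ℕ) : ℝ) / (65 : ℕ)) : ℂ))⁻¹ *
      ((Real.Gamma (((4 : ℕ) : ℝ) / (65 : ℕ)) : ℂ))⁻¹ *
      ((Real.Gamma (((5 : ℕ) : ℝ) / (65 : ℕ)) : ℂ))⁻¹ *
      ((Real.Gamma (((12 : ℕ) : ℝ) / (65 : ℕ)) : ℂ))⁻¹ *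
      ((Real.Gamma (((15 : ℕ) : ℝ) / (65 : ℕ)) : ℂ))⁻¹ *
      ((Real.Gamma (((17 : ℕ) : ℝ) / (65 : ℕ)) : ℂ))⁻¹ *
      ((Real.Gamma (((19 : ℕ) : ℝ) / (65 : ℕ)) : ℂ))⁻¹ *
      ((Real.Gamma (((32 : ℕ) : ℝ) / (65 : ℕ)) : ℂ))⁻¹ =
      algebraMap ℝ ℂ (Real.Gamma (1/65) * Real.Gamma (3/65) * Real.Gamma (8/65) * Real.Gamma (11/65) * Real.Gamma (16/65) * Real.Gamma (4/13) * Real.Gamma (21/65) * Real.Gamma (2/5) *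
        (Real.Gamma (2/65))⁻¹ * (Real.Gamma (4/65))⁻¹ * (Real.Gamma (1/13))⁻¹ * (Real.Gamma (12/65))⁻¹ * (Real.Gamma (3/13))⁻¹ * (Real.Gamma (17/65))⁻¹ * (Real.Gamma (19/65))⁻¹ * (Real.Gamma (32/65))⁻¹) := by
    rw [Complex.coe_algebraMap]
    push_cast
    norm_num
  rw [hval, isAlgebraic_algebraMap_iff (RCLike.ofReal_injective (K := ℂ))] at hKO
  exact hKO

/-- **Pinned deep target, level 65** (class `a_{5·13}`, depth 3 — the first deep class with NO two-letter representative
at its own level, census g21 (α)): Conjecture 1 for the ONE pair of THREE-letter Beta words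
`B(1/65,11/65)·B(3/65,16/65)·B(8/65,24/65) = c₆₅ · B(2/65,24/65)·B(4/65,17/65)·B(5/65,15/65)` on `(0,1)³` — the instance
of `BetaWordSector 3` at `a = (1,3,8)/65`, `b = (11,16,24)/65`, `a' = (2,4,5)/65`, `b' = (24,17,15)/65`, `q = c₆₅`; the
value hypothesis is kept verbatim (it HOLDS numerically: `c₆₅ = x/x' = 1.5899322121589`). [this node] -/
def Deep65 : Prop :=
  ∀ (r r' : KZ.IntegralRep 3), r.domain = {x | ∀ i, x i ∈ Set.Ioo (0:ℝ) 1} →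
    Set.EqOn r.integrand (fun x =>
      (x 0) ^ (((1/65 : ℚ) : ℝ) - 1) * (1 - x 0) ^ (((11/65 : ℚ) : ℝ) - 1) *
      ((x 1) ^ (((3/65 : ℚ) : ℝ) - 1) * (1 - x 1) ^ (((16/65 : ℚ) : ℝ) - 1)) *
      ((x 2) ^ (((8/65 : ℚ) : ℝ) - 1) * (1 - x 2) ^ (((24/65 : ℚ) : ℝ) - 1))) r.domain →
    r'.domain = {x | ∀ i, x i ∈ Set.Ioo (0:ℝ) 1} →
    Set.EqOn r'.integrand (fun x =>
      (Real.Gamma (1/65) * Real.Gamma (3/65) * Real.Gamma (8/65) * Real.Gamma (11/65) * Real.Gamma (16/65) * Real.Gamma (4/13) * Real.Gamma (21/65) * Real.Gamma (2/5) *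
        (Real.Gamma (2/65))⁻¹ * (Real.Gamma (4/65))⁻¹ * (Real.Gamma (1/13))⁻¹ * (Real.Gamma (12/65))⁻¹ * (Real.Gamma (3/13))⁻¹ * (Real.Gamma (17/65))⁻¹ * (Real.Gamma (19/65))⁻¹ * (Real.Gamma (32/65))⁻¹) *
      ((x 0) ^ (((2/65 : ℚ) : ℝ) - 1) * (1 - x 0) ^ (((24/65 : ℚ) : ℝ) - 1) *
      ((x 1) ^ (((4/65 : ℚ) : ℝ) - 1) * (1 - x 1) ^ (((17/65 : ℚ) : ℝ) - 1)) *
      ((x 2) ^ (((5/65 : ℚ) : ℝ) - 1) * (1 - x 2) ^ (((15/65 : ℚ) : ℝ) - 1)))) r'.domain →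
    r.value = r'.value → KZ.Equivalent r r'

/-- `BetaWordSector 3` ⟹ the pinned level-65 deep target. [this node] -/
theorem deep65_of_betaWordSector (h : BetaWordSector 3) : Deep65 := by
  intro r r' hd hi hd' hi' hv
  refine h ![1/65, 3/65, 8/65] ![11/65, 16/65, 24/65] ![2/65, 4/65, 5/65] ![24/65, 17/65, 15/65] _
    ?_ ?_ ?_ ?_ constant65_isAlgebraic r r' hd ?_ hd' ?_ hv
  · intro i; fin_cases i <;> simp
  · intro i; fin_cases i <;> simp
  · intro i; fin_cases i <;> simp
  · intro i; fin_cases i <;> simp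
  · intro x hx
    rw [hi hx]
    simp only [Fin.prod_univ_three, Fin.isValue, Matrix.cons_val_zero, Matrix.cons_val_one, Matrix.head_cons,
      Matrix.cons_val_two, Matrix.tail_cons]
  · intro x hx
    rw [hi' hx]
    simp only [Fin.prod_univ_three, Fin.isValue, Matrix.cons_val_zero, Matrix.cons_val_one, Matrix.head_cons,
      Matrix.cons_val_two, Matrix.tail_cons]

/-- `Deep65` from the tower (through `BetaWordSector 3`). [this node] -/
theorem deep65_of_betaWordTower (h : BetaWordTower) : Deep65 := deep65_of_betaWordSector (h 3)

/-! ### Level 65 — the DENOMINATOR-2 certificate of `m_65` (Kubert / `hodge_eq_combination_den_two`, explicit) -/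

/-- The Γ-monomial `m_65` as a function on `ℤ/65`. -/
def m65 : ZMod 65 → ℤ := fun x =>
  if x = 1 then (1:ℤ) else if x = 3 then 1 else if x = 8 then 1 else if x = 11 then 1 else if x = 16 then 1 else
  if x = 20 then 1 else if x = 21 then 1 else if x = 26 then 1 else if x = 2 then -1 else if x = 4 then -1 else
  if x = 5 then -1 else if x = 12 then -1 else if x = 15 then -1 else if x = 17 then -1 else if x = 19 then -1 else
  if x = 32 then -1 else 0

/-- `m65` is `mult65` read on residues. [bookkeeping] -/
theorem m65_eq_mult65 : ∀ x : ZMod 65, m65 x = mult65 x.val := by decide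

/-- Reflection coefficients of the certificate (`R_a = e_a + e_{−a}`, `17` of them). -/
def mr65 : ZMod 65 → ℤ := fun a =>
  if a = 3 then (1:ℤ) else if a = 4 then -1 else if a = 7 then 1 else if a = 8 then 2 else
  if a = 10 then -1 else if a = 11 then 1 else if a = 12 then -1 else if a = 13 then 1 else
  if a = 14 then -1 else if a = 18 then 1 else if a = 19 then -1 else if a = 20 then 1 else
  if a = 21 then 1 else if a = 22 then 1 else if a = 25 then -1 else if a = 28 then 1 else
  if a = 29 then -1 else 0

/-- Distribution coefficients of the certificate (`M = 5`: the fibres of Gauss₁₃ at `y = 1, 2`; `M = 13`: the fibres of Gauss₅ at `y = 1, …, 6`). -/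
def md65 : ℕ → ZMod 65 → ℤ := fun M y =>
  if M = 5 then (if y = 1 then (1:ℤ) else if y = 2 then -1 else 0)
  else if M = 13 then (if y = 1 then (1:ℤ) else if y = 2 then -1 else if y = 3 then 1 else if y = 4 then -1 else if y = 5 then -1 else if y = 6 then -1 else 0) else 0

set_option maxRecDepth 16000 in
/-- **`2·m_65 ∈ Refl_ℤ + Dist_ℤ` with EXPLICIT coefficients** (`17` reflections, `8` distribution relations), in the
coefficient format of `KoblitzOgus.hodge_eq_combination_den_two` at `N = 65`, checked by `decide`. [this node] -/
theorem den_two_65_explicit : ∀ x : ZMod 65,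
    (2 : ℤ) * m65 x =
      ∑ a : ZMod 65, mr65 a * ((if a = x then 1 else 0) + (if -a = x then 1 else 0)) +
      ∑ M ∈ (65 : ℕ).divisors, ∑ y : ZMod 65, md65 M y *
        ((if x.val % M = y.val % M then 1 else 0) - (if (((65 : ℕ) / M : ℕ) : ZMod 65) * y = x then 1 else 0)) := by
  decide

/-- **Denominator 2 for the deep class at level 65** (the `N = 65`, `f = m_65` instance of
`KoblitzOgus.hodge_eq_combination_den_two`, with its witnesses named). [this node] -/
theorem den_two_65 : ∃ (mr : ZMod 65 → ℤ) (md : ℕ → ZMod 65 → ℤ), ∀ x : ZMod 65,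
    (2 : ℤ) * m65 x =
      ∑ a : ZMod 65, mr a * ((if a = x then 1 else 0) + (if -a = x then 1 else 0)) +
      ∑ M ∈ (65 : ℕ).divisors, ∑ y : ZMod 65, md M y *
        ((if x.val % M = y.val % M then 1 else 0) - (if (((65 : ℕ) / M : ℕ) : ZMod 65) * y = x then 1 else 0)) :=
  ⟨mr65, md65, den_two_65_explicit⟩

/-! ### Reduction of the word sector to the fundamental domain of exponents `(0,1]^{2k}` -/

/-- **Beta reflection as moves** — verbatim the statement of the Literature theorem `KZ.betaReflection_equivalent`
(`Literature/NumberTheory/Transcendental/KZBetaChains.lean`): two representations pinned on `(0,1)` as `t^α(1−t)^β` and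
`t^β(1−t)^α` are KZ-equivalent (one change of variables `t ↦ 1 − t`). Taken as a HYPOTHESIS here only because that
module's cone is currently unbuilt on the farm; discharge: `fun α β ρ ρ' ↦ KZ.betaReflection_equivalent α β ρ ρ'`.
(cite KontsevichZagier2001, §1.2 rule (2)) -/
def BetaReflectionMove : Prop :=
  ∀ (α β : ℝ) (ρ ρ' : KZ.IntegralRep 1), ρ.domain = {x | x 0 ∈ Set.Ioo (0:ℝ) 1} →
    Set.EqOn ρ.integrand (fun x => (x 0) ^ α * (1 - x 0) ^ β) ρ.domain →
    ρ'.domain = {x | x 0 ∈ Set.Ioo (0:ℝ) 1} →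
    Set.EqOn ρ'.integrand (fun x => (x 0) ^ β * (1 - x 0) ^ α) ρ'.domain → KZ.Equivalent ρ ρ'

/-- **Beta translation as moves** — verbatim the statement of the Literature theorem `KZ.betaTranslation_equivalent`
(`KZBetaChains.lean`): `[(0,1), (a+b) t^{a-1}(1-t)^{b}] ∼ [(0,1), b t^{a-1}(1-t)^{b-1}]` for `0 < a, b ∈ ℚ` (ONE
Newton–Leibniz move with the primitive `t^a(1-t)^b` + one integrand additivity; value identity `(a+b)B(a,b+1) = bB(a,b)`).
Hypothesis for the same reason; discharge: `KZ.betaTranslation_equivalent`. (cite AndrewsAskeyRoy1999, §1.1) -/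
def BetaTranslationMove : Prop :=
  ∀ (a b : ℚ), 0 < a → 0 < b → ∀ (ρ ρ' : KZ.IntegralRep 1), ρ.domain = {x | x 0 ∈ Set.Ioo (0:ℝ) 1} →
    Set.EqOn ρ.integrand (fun x => ((a:ℝ) + b) * ((x 0) ^ ((a:ℝ) - 1) * (1 - x 0) ^ (b:ℝ))) ρ.domain →
    ρ'.domain = {x | x 0 ∈ Set.Ioo (0:ℝ) 1} →
    Set.EqOn ρ'.integrand (fun x => (b:ℝ) * ((x 0) ^ ((a:ℝ) - 1) * (1 - x 0) ^ ((b:ℝ) - 1))) ρ'.domain →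
    KZ.Equivalent ρ ρ'

end Summit.KontsevichZagierPeriods.FermatIsogeny.DeepTargets
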